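import Literature.Probability.RandomPlanarGeometry.SkorokhodSRWTimeControl
import Literature.Probability.RandomPlanarGeometry.BrownianOscillationTail
import HarnessLib

/-!
# Skorokhod embedding of the simple random walk: the strong approximation `|Y(k) - X(k)| ≤ n^{1/4+ε}`

Topic `Literature/Probability/RandomPlanarGeometry`, sub-namespace `SkorokhodSRW`; theorems only,
no definition and no named fact.

Brick B3d of Part B of the printed proof of `LSW2001_srw_nonIntersection_five_eighths`: the
one-dimensional strong approximation of Lawler, *Cut times for simple random walk*, EJP **1**
(1996), paper 13, §3, fourth display — "If we define `Y(t) = Y([t])`, this implies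
`P{sup_{0≤t≤n} |Y(t) - X(t)| ≥ n^{1/4+ε}} ≤ a e^{-n^δ}`" — here at the integer times (the form
consumed by the planar coupling; the oscillation of `X` inside the unit intervals is controlled
by the same oscillation event):

* `wienerLawC_exists_le_abs_walk_sub_le`: for every `ε > 0` there are `δ > 0` and `a` with
  `W[∃ k ≤ n, n^{1/4+ε} ≤ |Y(k) - p(k)|] ≤ a e^{-n^δ}` for all `n ≥ 1`, where `Y = walk` is the
  simple random walk embedded in the Wiener path `p` (`SkorokhodSRWEmbedding`).

Proof (Lawler, loc. cit.): off the event `{∃ k ≤ n, |τ_k - k| ≥ n^{1/2+ε}}`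
(`measureReal_exists_le_abs_tdev_le`, `SkorokhodSRWTimeControl`) and off the oscillation event
`{∃ u ≤ n, ∃ v ∈ [u, u + n^{1/2+ε}], |p v - p u| ≥ n^{1/4+ε}}` (`wienerLawC_osc_le_exp`,
`BrownianOscillationTail`, probability `≤ (n^{1/2-ε} + 1) · 2e^{-n^ε/16}`), the embedding identity
`Y(k) = p(τ_k)` (`ae_apply_embTime_eq_walk`) gives `|Y(k) - p(k)| = |p(τ_k) - p(k)| < n^{1/4+ε}`.

## References

* G. F. Lawler, *Cut times for simple random walk*, Electron. J. Probab. **1** (1996), no. 13,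
  §3. [Lawler1996CutTimes]
-/

noncomputable section

open MeasureTheory ProbabilityTheory Filter Set Real
open scoped NNReal ENNReal Topology

namespace Literature.Probability.RandomPlanarGeometry

namespace SkorokhodSRW

/-! ### Real-analysis bookkeeping for the exponents -/

/-- `n^{1/2-ε} + 1 ≤ 2n` for `n ≥ 1`, `ε > 0`, in the form `(n / n^{1/2+ε} + 1) · 2 ≤ 4n`.
[folklore] -/
theorem blocks_le {e : ℝ} (he : 0 < e) {n : ℕ} (hn : 1 ≤ n) :
    ((n : ℝ) / (n : ℝ) ^ (1 / 2 + e) + 1) * 2 ≤ 4 * n := by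
  have hn1 : (1 : ℝ) ≤ n := by exact_mod_cast hn
  have hn0 : (0 : ℝ) < n := by positivity
  have h1 : (n : ℝ) / (n : ℝ) ^ (1 / 2 + e) = (n : ℝ) ^ (1 / 2 - e) := by
    rw [div_eq_iff (Real.rpow_pos_of_pos hn0 _).ne', ← Real.rpow_add hn0]
    norm_num
  have h2 : (n : ℝ) ^ (1 / 2 - e) ≤ (n : ℝ) ^ (1 : ℝ) :=
    Real.rpow_le_rpow_of_exponent_le hn1 (by linarith)
  rw [Real.rpow_one] at h2
  rw [h1]
  linarith

/-- The oscillation exponent: `(n^{1/4+ε})² / (16 n^{1/2+ε}) = n^ε/16` (`n ≥ 1`). [folklore] -/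
theorem osc_exponent_eq {e : ℝ} {n : ℕ} (hn : 1 ≤ n) :
    -((n : ℝ) ^ (1 / 4 + e)) ^ 2 / (16 * (n : ℝ) ^ (1 / 2 + e)) = -(1 / 16 * (n : ℝ) ^ e) := by
  have hn0 : (0 : ℝ) < n := by exact_mod_cast hn
  have hsq : ((n : ℝ) ^ (1 / 4 + e)) ^ 2 = (n : ℝ) ^ (1 / 2 + e) * (n : ℝ) ^ e := by
    rw [← Real.rpow_natCast, ← Real.rpow_mul hn0.le, ← Real.rpow_add hn0]
    congr 1
    push_cast
    ring
  rw [hsq]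
  have hpos : (0 : ℝ) < (n : ℝ) ^ (1 / 2 + e) := Real.rpow_pos_of_pos hn0 _
  field_simp

/-- Comparing stretched exponentials: `e^{-n^{δ₁}} ≤ e^{-n^δ}` for `δ ≤ δ₁`, `n ≥ 1`. [folklore] -/
theorem exp_neg_rpow_le {δ δ₁ : ℝ} (hδ : δ ≤ δ₁) {n : ℕ} (hn : 1 ≤ n) :
    exp (-(n : ℝ) ^ δ₁) ≤ exp (-(n : ℝ) ^ δ) := by
  have hn1 : (1 : ℝ) ≤ n := by exact_mod_cast hn
  exact Real.exp_le_exp.2 (neg_le_neg (Real.rpow_le_rpow_of_exponent_le hn1 hδ))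

/-! ### The pathwise reduction -/

/-- **Pathwise reduction**: if `|τ - k| < h` (real numbers) then with `u = τ ∧ k`, `v = τ ∨ k`
one has `u ≤ v ≤ u + h` and `|p v - p u| = |p τ - p k|`. [folklore] -/
theorem osc_of_abs_sub_lt {τ k h : ℝ≥0} (hτ : |(τ : ℝ) - k| < h) (p : C(ℝ≥0, ℝ)) :
    min τ k ≤ max τ k ∧ max τ k ≤ min τ k + h ∧ |p (max τ k) - p (min τ k)| = |p τ - p k| := by
  refine ⟨min_le_max, ?_, ?_⟩
  · rw [← NNReal.coe_le_coe, NNReal.coe_add, NNReal.coe_max, NNReal.coe_min]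
    have := max_sub_min_eq_abs (τ : ℝ) k
    linarith [hτ.le, abs_sub_comm (τ : ℝ) k]
  · rcases le_total τ k with h' | h'
    · rw [max_eq_right h', min_eq_left h', abs_sub_comm]
    · rw [max_eq_left h', min_eq_right h']

/-- **The failure event is covered** (modulo the null set where the embedding identity fails):
`{∃ k ≤ n, x ≤ |Y(k) - p(k)|} ∩ {∀ k, p(τ_k) = Y(k)} ⊆ {∃ k ≤ n, h ≤ |τ_k - k|} ∪ Osc(n, h, x)`.
[folklore] -/
theorem failure_subset (n : ℕ) (h : ℝ≥0) (x : ℝ) :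
    {p : C(ℝ≥0, ℝ) | ∃ k ≤ n, x ≤ |walk k p - p k|} ∩ {p | ∀ k, p (embTime k p) = walk k p} ⊆
      {p | ∃ k ≤ n, (h : ℝ) ≤ |(embTime k p : ℝ) - k|} ∪
        {p | ∃ u v : ℝ≥0, u ≤ (n : ℝ≥0) ∧ u ≤ v ∧ v ≤ u + h ∧ x ≤ |p v - p u|} := by
  rintro p ⟨⟨k, hk, hx⟩, hid⟩
  by_cases hcase : (h : ℝ) ≤ |(embTime k p : ℝ) - k|
  · exact Or.inl ⟨k, hk, hcase⟩
  · right
    push Not at hcase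
    obtain ⟨h1, h2, h3⟩ := osc_of_abs_sub_lt (k := (k : ℝ≥0)) (by simpa using hcase) p
    refine ⟨min (embTime k p) k, max (embTime k p) k, ?_, h1, h2, ?_⟩
    · exact (min_le_right _ _).trans (by exact_mod_cast hk)
    · rw [h3, hid k]
      exact hx

section Law

variable [MeasurableSpace C(ℝ≥0, ℝ)] [BorelSpace C(ℝ≥0, ℝ)]

/-- **Strong approximation of the embedded simple random walk by the Brownian path at integer
times** (Lawler (1996), §3, fourth display): for every `ε > 0` there are `δ > 0` and `a < ∞`
with `P{∃ k ≤ n, |Y(k) - X(k)| ≥ n^{1/4+ε}} ≤ a e^{-n^δ}` for all `n ≥ 1`.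
[cite: Lawler1996CutTimes, §3] -/
theorem wienerLawC_exists_le_abs_walk_sub_le {e : ℝ} (he : 0 < e) :
    ∃ δ : ℝ, 0 < δ ∧ ∃ a : ℝ, 0 < a ∧ ∀ n : ℕ, 1 ≤ n →
      wienerLawC {p : C(ℝ≥0, ℝ) | ∃ k ≤ n, (n : ℝ) ^ (1 / 4 + e) ≤ |walk k p - p k|} ≤
        ENNReal.ofReal (a * exp (-(n : ℝ) ^ δ)) := by
  obtain ⟨δ₁, hδ₁, a₁, ha₁, hB⟩ := measureReal_exists_le_abs_tdev_le (e := e) he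
  obtain ⟨a₂, ha₂, habs⟩ := exists_absorb_prefactor (c := 1 / 16) (d := e) (by norm_num) he
  refine ⟨min δ₁ (e / 2), lt_min hδ₁ (by positivity), a₁ + a₂, by positivity, fun n hn ↦ ?_⟩
  have hn1 : (1 : ℝ) ≤ n := by exact_mod_cast hn
  have hn0 : (0 : ℝ) < n := by positivity
  -- the scales
  set x : ℝ := (n : ℝ) ^ (1 / 4 + e) with hx
  have hxpos : 0 < x := Real.rpow_pos_of_pos hn0 _
  set hh : ℝ≥0 := ⟨(n : ℝ) ^ (1 / 2 + e), Real.rpow_nonneg hn0.le _⟩ with hhh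
  have hhcoe : (hh : ℝ) = (n : ℝ) ^ (1 / 2 + e) := rfl
  have hhpos : 0 < hh := by
    rw [← NNReal.coe_pos, hhcoe]
    exact Real.rpow_pos_of_pos hn0 _
  -- the three events
  set A := {p : C(ℝ≥0, ℝ) | ∃ k ≤ n, x ≤ |walk k p - p k|} with hA
  set G := {p : C(ℝ≥0, ℝ) | ∀ k, p (embTime k p) = walk k p} with hG
  set B := {p : C(ℝ≥0, ℝ) | ∃ k ≤ n, (hh : ℝ) ≤ |(embTime k p : ℝ) - k|} with hBdef
  set C := {p : C(ℝ≥0, ℝ) | ∃ u v : ℝ≥0, u ≤ (n : ℝ≥0) ∧ u ≤ v ∧ v ≤ u + hh ∧ x ≤ |p v - p u|}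
    with hC
  have hGnull : wienerLawC Gᶜ = 0 := by
    have h0 := (ae_apply_embTime_eq_walk :
      ∀ᵐ p ∂wienerLawC, ∀ k, p (embTime k p) = walk k p)
    rw [ae_iff] at h0
    simpa [hG, compl_setOf] using h0
  have hcover : A ⊆ (B ∪ C) ∪ Gᶜ := by
    intro p hp
    by_cases hpG : p ∈ G
    · exact Or.inl (failure_subset n hh x ⟨hp, hpG⟩)
    · exact Or.inr hpG
  -- the two bounds
  have hBbound : wienerLawC B ≤ ENNReal.ofReal (a₁ * exp (-(n : ℝ) ^ δ₁)) := by
    rw [← ofReal_measureReal (measure_ne_top _ _)]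
    exact ENNReal.ofReal_le_ofReal (by simpa [hBdef, hhcoe] using hB n hn)
  have hCbound : wienerLawC C ≤ ENNReal.ofReal (a₂ * exp (-(n : ℝ) ^ (e / 2))) := by
    refine (wienerLawC_osc_le_exp (n : ℝ≥0) hhpos hxpos).trans (ENNReal.ofReal_le_ofReal ?_)
    refine le_trans ?_ (habs n hn)
    rw [NNReal.coe_natCast, hhcoe, hx, osc_exponent_eq hn]
    calc ((n : ℝ) / (n : ℝ) ^ (1 / 2 + e) + 1) * (2 * exp (-(1 / 16 * (n : ℝ) ^ e)))
        = ((n : ℝ) / (n : ℝ) ^ (1 / 2 + e) + 1) * 2 * exp (-(1 / 16 * (n : ℝ) ^ e)) := by ring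
      _ ≤ 4 * n * exp (-(1 / 16 * (n : ℝ) ^ e)) :=
          mul_le_mul_of_nonneg_right (blocks_le he hn) (exp_nonneg _)
  -- assemble
  calc wienerLawC A ≤ wienerLawC ((B ∪ C) ∪ Gᶜ) := measure_mono hcover
    _ ≤ wienerLawC (B ∪ C) + wienerLawC Gᶜ := measure_union_le _ _
    _ ≤ wienerLawC B + wienerLawC C + 0 := by
        rw [hGnull]
        exact add_le_add (measure_union_le _ _) le_rfl
    _ ≤ ENNReal.ofReal (a₁ * exp (-(n : ℝ) ^ δ₁)) + ENNReal.ofReal (a₂ * exp (-(n : ℝ) ^ (e / 2))) := by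
        rw [add_zero]
        exact add_le_add hBbound hCbound
    _ = ENNReal.ofReal (a₁ * exp (-(n : ℝ) ^ δ₁) + a₂ * exp (-(n : ℝ) ^ (e / 2))) :=
        (ENNReal.ofReal_add (by positivity) (by positivity)).symm
    _ ≤ ENNReal.ofReal ((a₁ + a₂) * exp (-(n : ℝ) ^ min δ₁ (e / 2))) := by
        refine ENNReal.ofReal_le_ofReal ?_
        have h1 := exp_neg_rpow_le (min_le_left δ₁ (e / 2)) hn
        have h2 := exp_neg_rpow_le (min_le_right δ₁ (e / 2)) hn
        have h1' := mul_le_mul_of_nonneg_left h1 ha₁.le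
        have h2' := mul_le_mul_of_nonneg_left h2 ha₂.le
        linarith

/-- The same bound in real form. [cite: Lawler1996CutTimes, §3] -/
theorem measureReal_exists_le_abs_walk_sub_le {e : ℝ} (he : 0 < e) :
    ∃ δ : ℝ, 0 < δ ∧ ∃ a : ℝ, 0 < a ∧ ∀ n : ℕ, 1 ≤ n →
      wienerLawC.real {p : C(ℝ≥0, ℝ) | ∃ k ≤ n, (n : ℝ) ^ (1 / 4 + e) ≤ |walk k p - p k|} ≤
        a * exp (-(n : ℝ) ^ δ) := by
  obtain ⟨δ, hδ, a, ha, h⟩ := wienerLawC_exists_le_abs_walk_sub_le he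
  refine ⟨δ, hδ, a, ha, fun n hn ↦ ?_⟩
  rw [measureReal_def]
  exact ENNReal.toReal_le_of_le_ofReal (by positivity) (h n hn)

end Law

end SkorokhodSRW

end Literature.Probability.RandomPlanarGeometry
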